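import Summits.QuantumAdvantage.AdviceFreeQNC0.OddPrimeStatements
import Literature.Computability.MetaComplexity.RazborovSmolenskyPoly
import Mathlib.FieldTheory.Finite.Basic
import HarnessLib

/-!
# Cell qa-qnc0 (odd primes `p ≥ 5`): LINEAR-TEST selections sit inside the u-walk crux — `LinSelOfWalkHardF p`

Planner qa-qnc0-p2 g13, ROUND-13 §3♯ / `line13/Sketch13p2.lean` §6 (statements `LinSel`, `WalkHardFLinSel p` = rung R5,
`LinSelOfWalkHardF p` VERBATIM).  PROVED here (support statement, S):

* `hasDegF_of_linSel` — a MOD_p test of an `𝔽_p`-linear form, `y_g(u) = [Σ_i ℓ_{g,i} u_i = r_g]`, has `𝔽_p`-degree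
  `≤ p − 1` (`[a = r] = 1 − (a − r)^{p−1}`, Fermat);
* **`linSelOfWalkHardF : LinSelOfWalkHardF p`** for every prime `p` — `WalkHardF p → WalkHardFLinSel p`: the crux at
  exponent `C = 1` covers linear-test players as soon as `p − 1 ≤ log₂ n`.

So rung R5 (`WalkHardFLinSel p`, the `d = 1` level of the CDH ladder in the game's constrained form, ROUND-13 §3♯) is a
genuine special case of `WalkHardF p`.  WHAT THIS IS NOT: R5 itself is NOT proved (it needs the BST90 / Krause–Pudlák /
Grolmusz–Tardos depth-2 machinery); nothing on the dense crux; separation NOT moved.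
-/

noncomputable section

namespace Summit.QuantumAdvantage.AdviceFreeQNC0

open Classical
open Finset
open Literature.Computability.MetaComplexity Literature.Computability.MetaComplexity.Smolensky

/-! ### Statements (planner qa-qnc0-p2 Sketch13p2 §6, verbatim) -/

/-- Selections that are MOD_p tests of 𝔽_p-LINEAR forms: `y_g(u) = [Σ_i ℓ_{g,i} u_i = r_g]` (inactive: ℓ = 0, r = 1).
(Sketch13p2 §6, verbatim.) -/
def LinSel (p : ℕ) [Fact p.Prime] {n : ℕ} (y : Fin (n + 1) → (Fin n → Bool) → Bool) : Prop :=
  ∀ g, ∃ ℓ : Fin n → ZMod p, ∃ r : ZMod p, ∀ u,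
    y g u = decide ((Finset.univ.sum fun i => if u i then ℓ i else 0) = r)

/-- **R5 `WalkHardFLinSel p`** (rung, M–L; the d = 1 level of the CDH ladder, in the game's constrained form): linear-test
players win the u-game on at most `θ·2ⁿ` inputs.  In combined-modulus form the win indicator is
`⊕_g [M_g(u) ∈ A_g (mod 3p)]`, `M_g = CRT(L_g, T_g)`, `A_g = {r_g} × {1,2}` — a LINEAR-size depth-2 `MOD₂∘MOD_{3p}` circuit
whose ℤ₃-parts are prescribed; tools: the BST90 / Krause–Pudlák / Grolmusz–Tardos depth-2 machinery.  Why it might fail: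
short-support forms do correlate with `|u| mod 3` at small n (hill-climb, p = 5: best found 0.77 @ n=10, 0.70 @ n=14,
in-session) — the claim is only `∃ θ < 1` asymptotically; a proof must still handle Ω(n) active tests per input.
(Sketch13p2 §6, verbatim; OPEN.) -/
def WalkHardFLinSel (p : ℕ) [Fact p.Prime] : Prop :=
  ∃ θ : ℝ, θ < 1 ∧ ∃ n₀ : ℕ, ∀ n ≥ n₀, ∀ c : ℕ,
    ∀ y : Fin (n + 1) → (Fin n → Bool) → Bool, LinSel p y →
      ((univ.filter fun u : Fin n → Bool => ringWinU c y u = true).card : ℝ) ≤ θ * (2 : ℝ) ^ n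

/-- `R5` sits inside the target: linear tests have degree ≤ 1 ≤ (log₂ n)^C once n ≥ 2 (support statement, S).
PROVED: `linSelOfWalkHardF` (the `𝔽_p`-degree of a MOD_p test of a linear form is `p − 1`, so `C = 1` and
`n ≥ 2^{p−1}` are used). (Sketch13p2 §6, verbatim.) -/
def LinSelOfWalkHardF (p : ℕ) [Fact p.Prime] : Prop := WalkHardF p → WalkHardFLinSel p

/-! ### Linear tests have degree `p − 1` -/

variable {p : ℕ} [Fact p.Prime] {n : ℕ}

/-- `[a = r] = 1 − (a − r)^{p−1}` in `𝔽_p` (Fermat). -/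
theorem ind_eq_const_eq (a r : ZMod p) : (if a = r then (1 : ZMod p) else 0) = 1 - (a - r) ^ (p - 1) := by
  have hp : 1 < p := (Fact.out : p.Prime).one_lt
  by_cases h : a = r
  · rw [if_pos h, h, sub_self, zero_pow (by omega), sub_zero]
  · rw [if_neg h, ZMod.pow_card_sub_one_eq_one (sub_ne_zero.mpr h), sub_self]

/-- The `𝔽_p`-linear form `u ↦ Σ_i ℓ_i u_i` has degree `≤ 1`. -/
theorem linForm_mem_lowDeg (ℓ : Fin n → ZMod p) :
    (fun u : Fin n → Bool => ∑ i, (if u i then ℓ i else 0)) ∈ lowDeg (ZMod p) n 1 := by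
  have heq : (fun u : Fin n → Bool => ∑ i, (if u i then ℓ i else 0)) =
      ∑ i : Fin n, ℓ i • fun u : Fin n → Bool => if u i then (1 : ZMod p) else 0 := by
    funext u
    simp only [Finset.sum_apply, Pi.smul_apply, smul_eq_mul]
    refine Finset.sum_congr rfl fun i _ => ?_
    split_ifs <;> simp
  rw [heq]
  exact Submodule.sum_mem _ fun i _ => Submodule.smul_mem _ _ (bitFn_mem_lowDeg i le_rfl)

/-- **A MOD_p test of a linear form has `𝔽_p`-degree `≤ p − 1`.** -/
theorem hasDegF_linTest (ℓ : Fin n → ZMod p) (r : ZMod p) :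
    HasDegF p (fun u : Fin n → Bool => decide ((∑ i, (if u i then ℓ i else 0)) = r)) (p - 1) := by
  unfold HasDegF
  have heq : (fun u : Fin n → Bool => if decide ((∑ i, (if u i then ℓ i else 0)) = r) = true then (1 : ZMod p) else 0) =
      1 - ((fun u : Fin n → Bool => ∑ i, (if u i then ℓ i else 0)) - fun _ => r) ^ (p - 1) := by
    funext u
    simp only [decide_eq_true_eq, Pi.sub_apply, Pi.pow_apply, Pi.one_apply]
    exact ind_eq_const_eq _ r
  rw [heq]
  have hconst : (fun _ : Fin n → Bool => r) ∈ lowDeg (ZMod p) n 1 := by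
    have : (fun _ : Fin n → Bool => r) = r • (1 : CubeFn (ZMod p) n) := by
      funext u; simp
    rw [this]
    exact Submodule.smul_mem _ _ (one_mem_lowDeg 1)
  have h1 : ((fun u : Fin n → Bool => ∑ i, (if u i then ℓ i else 0)) - fun _ => r) ∈ lowDeg (ZMod p) n 1 :=
    Submodule.sub_mem _ (linForm_mem_lowDeg ℓ) hconst
  have hpow := pow_mem_lowDeg h1 (p - 1)
  rw [Nat.mul_one] at hpow
  exact Submodule.sub_mem _ (one_mem_lowDeg _) hpow

/-- Every linear-test strategy has selections of `𝔽_p`-degree `≤ p − 1`. -/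
theorem hasDegF_of_linSel {y : Fin (n + 1) → (Fin n → Bool) → Bool} (hy : LinSel p y) (g : Fin (n + 1)) :
    HasDegF p (y g) (p - 1) := by
  obtain ⟨ℓ, r, h⟩ := hy g
  have heq : y g = fun u => decide ((∑ i, (if u i then ℓ i else 0)) = r) := funext h
  rw [heq]
  exact hasDegF_linTest ℓ r

/-! ### R5 is inside the crux -/

/-- **`LinSelOfWalkHardF p` — PROVED for every prime `p`**: `WalkHardF p → WalkHardFLinSel p` (take `C = 1` and
`n ≥ 2^{p−1}`, so that `p − 1 ≤ log₂ n`). -/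
theorem linSelOfWalkHardF (p : ℕ) [Fact p.Prime] : LinSelOfWalkHardF p := by
  rintro ⟨θ, hθ, hW⟩
  obtain ⟨n₀, hn₀⟩ := hW 1
  refine ⟨θ, hθ, max n₀ (2 ^ (p - 1)), fun n hn c y hy => hn₀ n (le_trans (le_max_left _ _) hn) c y fun g => ?_⟩
  have hlog : p - 1 ≤ (Nat.log 2 n) ^ 1 := by
    rw [pow_one]
    exact Nat.le_log_of_pow_le (by norm_num) (le_trans (le_max_right _ _) hn)
  unfold HasDegF
  exact lowDeg_mono hlog (hasDegF_of_linSel hy g)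

end Summit.QuantumAdvantage.AdviceFreeQNC0

end
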